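import Summits.QuantumFields.YangMills.Theorems.BalabanUVNodesN15BackgroundSiteNeumann
import Summits.QuantumFields.YangMills.Theorems.BalabanUVNodesN15BackgroundAveragingWords
import HarnessLib

/-!
# Route «BalabanUVNodes» (K4 «SpineRates»), node N15 = NE2 — THE SITE-KERNEL LAYER WITH THE BACKGROUND LIVE, II: THE DRESSED SITE FORM
# `K(A) = Q′(U′U)G′²(U′U)Q′*(U′U) = (Q + F₂)X²(Q* + F₂*)` of [B9] (3.65) at `U ≡ 1`, its perturbation `C(A) = K(A) − QG²Q*` with a (3.66)-shaped majorant,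
# and the η-defect `𝔇(K′, K)` BY LEIBNIZ from the operator layer's letters — the averaging operators intertwining EXACTLY

Cell `pub-ymgap`, seat `pub-ymgap-dag-n15-c` (generation g5; R134 ACCELERATION SEAT, strategy s1; HUMAN RULING D-0062; chair R424 venue; `bears_on: R4∕N15`).  Filed
`--supports stmt-QuantumFields-20292 --as helper` (K3⁗; count-neutral).  Imports this seat's S1 `…N15BackgroundSiteNeumann` (the Neumann device ∕ exact inverse rule the
letters below feed) and g4's F1 `…N15BackgroundAveragingWords` (`fibAvg`, `fibAvg_comp_pull`, `idef_fibAvg_eq_zero`, `idef_pull_eq_zero`, `hasMaj_fibAvg`,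
`hasMaj_add_diagK`), through them `T4EtaRateDefect` (`idef`, `idef_comp`, `idef_add`), `T4EtaRateCoeffDefect` (`pull`, `diagK`, `hasMaj_pull`), `B11SectG` BY NAME;
nothing in the tree is modified.

THE PRINT (SHAPE and MECHANISM only; nothing of [B9] asserted).  [Balaban1985BackgroundPropagators] p. 403: *«Q′(U′U)G′²(U′U)Q′*(U′U) = Q′(U)G′²(U)Q′*(U) +
F′₂(A)G′²(U′U)Q′*(U) + Q′(U)G′²(U′U)F′₂*(A) + F′₂(A)G′²(U′U)F′₂*(A) + Q′(U)G′(U′U)V′(A)G′²(U)Q′*(U) + … = Q′(U)G′²(U)Q′*(U) + C(A), (3.65) where the operator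
C(A) is defined by the last equality. Using the results obtained for operators building it, and Lemma 2.1 [4] … we get |C(A; y, y′)| ≦ O(1)α₁ … e^{−(1∕2)δ₀d(y,y′)}
(3.66)»*.  HERE, at `U ≡ 1` and in the lineage's currency: `Q = fibAvg q` (the block mean, g4 F1), `Q* = pull q`, `Q′(U′U) − Q′ = F₂`, `Q′*(U′U) − Q′* = F₂*` (the
averaging-perturbation species of (3.58), block-local letters `r`, fit letters `o` — g4 F7∕F9 construct them), `G′(U′U) = X` (the DRESSED propagator of the operator
layer, n15-b B1∕this seat's M-, G-, V-files: majorant `B·e^{−δd}`, η-defect `m·e^{−δd}`), `G′(U) = G` (the `U ≡ 1` piece), and `X − G = E` small (`= GV′X` by (3.65),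
majorant `ε·e^{−δd}`); so `K := (Q + F₂)∘X∘X∘(Q* + F₂*)` and `C := K − QG²Q* = F₂X²(Q* + F₂*) + QX²F₂* + Q(XE + EG)Q*` (`siteForm_sub_siteForm₀`, an
algebraically equivalent grouping of the print's seven terms).

CONTENTS ([folklore]: finite-dimensional linear algebra + the lineage's lemmas BY NAME; 2 defs).
* §0 composition helpers in the lineage's two currencies (`hasMaj_exp_comp_diagK`, `hasMaj_diagK_comp_exp`, `hasMaj_add_exp`, `hasMaj_exp_mono`).
* §1 `siteForm q F Fs X`, `siteForm₀ q G`, `siteForm_sub_siteForm₀` ((3.65) as an operator identity).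
* §2 `hasMaj_XXP` (`X²(Q* + F₂*) ≤ B²(1 + r)c_r·e^{−ρd}`), ★ `hasMaj_siteC` ((3.66)-shaped: `C ≤ [rB²(1+r) + B²r + (B+β)ε]c_r·e^{−ρd}` — small in the `F`-letters and `E`).
* §3 ★ **`hasMaj_idef_siteForm`** — under uniform pairing fibres (King's pairing: `Q′τ = Q`, `Q′* = τQ*` EXACTLY, g4 F1) the η-defect of the dressed site form
  through the identity transport of the common site lattice is carried by `𝔇(X′, X)`, `𝔇(F₂′, F₂)`, `𝔇(F₂*′, F₂*)` ALONE:
  `𝔇(K′, K) ≤ 2(1 + r)·B·c_r·(B·o + m·(1 + r))·e^{−ρd}` (`ρ + σ ≤ δ`).  Fed to S1's `hasMaj_idef_siteInv` this is the η-rate of the dressed site KERNEL.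

HONEST FRAMING ∕ LIMITS.  MECHANISM + linear algebra over hypothesis-shaped data: every operator and letter is a BINDER (the sequel instantiates them at the
lineage's constructed operator layer); common site lattice `Y` for both spacings; scalar-valued lattice functions (the `⊗ 1_𝔤` ∕ matrix species enter through
the product carriers of the instantiation, as in M4∕G3).  Nothing about Bałaban's `G(U)`, `Q(U)` is asserted; `U ≡ 1` is the background around which `U′`
perturbs.  NE2⁺ NOT PRINTED, NOT proved; count-neutral (typed 28∕28; discharged count unchanged); N15 NOT discharged; one finite T⁴ at fixed ε — NOT infinite
volume, NOT OS on ℝ⁴, NOT a mass gap, NOT Clay.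
-/

noncomputable section

namespace Summit.QuantumFields.YangMills.BalabanUVNodes.N15.SiteLayer

open Literature.MathematicalPhysics.QuantumFieldTheory.Balaban1983to89
open Literature.MathematicalPhysics.QuantumFieldTheory.Balaban1983to89.B11SectG (BlockNorm HasMaj hasMaj_comp hasMaj_comp_exp RowSum)
open Literature.MathematicalPhysics.QuantumFieldTheory.Balaban1983to89.T4EtaRateDefect (idef idef_comp idef_add idef_sub)
open Literature.MathematicalPhysics.QuantumFieldTheory.Balaban1983to89.T4EtaRateCoeffDefect (pull pull_apply diagK diagK_nonneg diagK_mono fibre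
  hasMaj_pull)
open Literature.MathematicalPhysics.QuantumFieldTheory.Balaban1983to89.B6RandomWalk (Triangle254)
open Summit.QuantumFields.YangMills.BalabanUVNodes.N15.DerivDefect (sum_mul_diagK sum_diagK_mul)
open Summit.QuantumFields.YangMills.BalabanUVNodes.N15.BackgroundModel (kappa_ofBlocks)
open Summit.QuantumFields.YangMills.BalabanUVNodes.N15.BackgroundLayer (fibAvg fibAvg_comp_pull idef_fibAvg_eq_zero idef_pull_eq_zero hasMaj_fibAvg
  hasMaj_add_diagK)

/-! ## §0 Composition helpers: a decaying letter against a diagonal one -/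

section Helpers

variable {g : B6.Geometry} {F₁ F₃ : Type} [AddCommGroup F₁] [Module ℝ F₁] [AddCommGroup F₃] [Module ℝ F₃] {X₂ : Type} [Fintype X₂]
  (blk₂ : X₂ → g.Site)

/-- `T₁ ≤ a·e^{−ρd}` AFTER `T₂ ≤ diagK o` through a sharp-block middle space: `T₁∘T₂ ≤ a·o·e^{−ρd}` (no row sum, no rate loss). [folklore] -/
theorem hasMaj_exp_comp_diagK {b₁ : BlockNorm g F₁} {b₃ : BlockNorm g F₃} {T₁ : (X₂ → ℝ) →ₗ[ℝ] F₃} {T₂ : F₁ →ₗ[ℝ] (X₂ → ℝ)} {a ρ o : ℝ}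
    (ha : 0 ≤ a) (h₁ : HasMaj (BlockNorm.ofBlocks g blk₂) b₃ T₁ (fun y y' => a * Real.exp (-(ρ * g.dist y y'))))
    (h₂ : HasMaj b₁ (BlockNorm.ofBlocks g blk₂) T₂ (diagK fun _ => o)) :
    HasMaj b₁ b₃ (T₁ ∘ₗ T₂) (fun y y' => a * o * Real.exp (-(ρ * g.dist y y'))) := by
  refine (hasMaj_comp h₁ h₂ fun _ _ => mul_nonneg ha (Real.exp_nonneg _)).mono fun y y' => le_of_eq ?_
  rw [kappa_ofBlocks]
  simp only [one_mul]
  rw [sum_mul_diagK]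
  ring

/-- `T₁ ≤ diagK o` (`o ≥ 0`) AFTER `T₂ ≤ a·e^{−ρd}` through a sharp-block middle space: `T₁∘T₂ ≤ o·a·e^{−ρd}`. [folklore] -/
theorem hasMaj_diagK_comp_exp {b₁ : BlockNorm g F₁} {b₃ : BlockNorm g F₃} {T₁ : (X₂ → ℝ) →ₗ[ℝ] F₃} {T₂ : F₁ →ₗ[ℝ] (X₂ → ℝ)} {a ρ o : ℝ}
    (ho : 0 ≤ o) (h₁ : HasMaj (BlockNorm.ofBlocks g blk₂) b₃ T₁ (diagK fun _ => o))
    (h₂ : HasMaj b₁ (BlockNorm.ofBlocks g blk₂) T₂ (fun y y' => a * Real.exp (-(ρ * g.dist y y')))) :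
    HasMaj b₁ b₃ (T₁ ∘ₗ T₂) (fun y y' => o * a * Real.exp (-(ρ * g.dist y y'))) := by
  refine (hasMaj_comp h₁ h₂ fun _ _ => diagK_nonneg (fun _ => ho) _ _).mono fun y y' => le_of_eq ?_
  rw [kappa_ofBlocks]
  simp only [one_mul]
  rw [sum_diagK_mul]
  ring

variable {F₂ : Type} [AddCommGroup F₂] [Module ℝ F₂]

/-- Same-rate majorants ADD. [folklore] -/
theorem hasMaj_add_exp {b₁ : BlockNorm g F₁} {b₂ : BlockNorm g F₂} {T₁ T₂ : F₁ →ₗ[ℝ] F₂} {a₁ a₂ ρ : ℝ}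
    (h₁ : HasMaj b₁ b₂ T₁ (fun y y' => a₁ * Real.exp (-(ρ * g.dist y y')))) (h₂ : HasMaj b₁ b₂ T₂ (fun y y' => a₂ * Real.exp (-(ρ * g.dist y y')))) :
    HasMaj b₁ b₂ (T₁ + T₂) (fun y y' => (a₁ + a₂) * Real.exp (-(ρ * g.dist y y'))) :=
  (h₁.add h₂).mono fun _ _ => le_of_eq (by ring)

/-- A decaying majorant at rate `δ` is one at every slower rate `ρ ≤ δ` (`a ≥ 0`, `d ≥ 0`). [folklore] -/
theorem hasMaj_exp_mono (hd : ∀ a b : g.Site, 0 ≤ g.dist a b) {b₁ : BlockNorm g F₁} {b₂ : BlockNorm g F₂} {T : F₁ →ₗ[ℝ] F₂} {a δ ρ : ℝ}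
    (ha : 0 ≤ a) (hρδ : ρ ≤ δ) (h : HasMaj b₁ b₂ T (fun y y' => a * Real.exp (-(δ * g.dist y y')))) :
    HasMaj b₁ b₂ T (fun y y' => a * Real.exp (-(ρ * g.dist y y'))) :=
  h.mono fun y y' => mul_le_mul_of_nonneg_left (Real.exp_le_exp.mpr (by nlinarith [hd y y'])) ha

end Helpers

/-! ## §1 The dressed site form of (3.65) and its `U ≡ 1` member -/

section Forms

variable {X Y : Type} [Fintype X] [DecidableEq Y]

/-- THE DRESSED SITE FORM `K = (Q + F₂)∘X∘X∘(Q* + F₂*)` (= `Q′(U′U)G′²(U′U)Q′*(U′U)` at `U ≡ 1`: `Q′(U′U) = Q + F₂`, `G′(U′U) = X`). [cite: Balaban1985BackgroundPropagators, (3.65) p.403 (shape)] -/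
def siteForm (q : X → Y) (F : (X → ℝ) →ₗ[ℝ] (Y → ℝ)) (Fs : (Y → ℝ) →ₗ[ℝ] (X → ℝ)) (Xo : (X → ℝ) →ₗ[ℝ] (X → ℝ)) :
    (Y → ℝ) →ₗ[ℝ] (Y → ℝ) :=
  (fibAvg q + F) ∘ₗ (Xo ∘ₗ (Xo ∘ₗ (pull q + Fs)))

/-- THE `U ≡ 1` SITE FORM `K₀ = Q∘G∘G∘Q*` (= `Q′(U)G′²(U)Q′*(U)` at `U ≡ 1`, the operator Thm 3.2 (3.48) inverts). [cite: Balaban1985BackgroundPropagators, Thm 3.2 (3.48) p.398 + (3.65) p.403 (shape)] -/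
def siteForm₀ (q : X → Y) (G : (X → ℝ) →ₗ[ℝ] (X → ℝ)) : (Y → ℝ) →ₗ[ℝ] (Y → ℝ) :=
  fibAvg q ∘ₗ (G ∘ₗ (G ∘ₗ pull q))

/-- **(3.65) AS AN OPERATOR IDENTITY**: `K − K₀ = F₂X²(Q* + F₂*) + QX²F₂* + Q(X(X − G) + (X − G)G)Q*`. [cite: Balaban1985BackgroundPropagators, (3.65) p.403 (shape: «= Q′(U)G′²(U)Q′*(U) + C(A), where the operator C(A) is defined by the last equality»)] -/
theorem siteForm_sub_siteForm₀ (q : X → Y) (F : (X → ℝ) →ₗ[ℝ] (Y → ℝ)) (Fs : (Y → ℝ) →ₗ[ℝ] (X → ℝ)) (Xo G : (X → ℝ) →ₗ[ℝ] (X → ℝ)) :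
    siteForm q F Fs Xo - siteForm₀ q G =
      F ∘ₗ (Xo ∘ₗ (Xo ∘ₗ (pull q + Fs))) + fibAvg q ∘ₗ (Xo ∘ₗ (Xo ∘ₗ Fs)) +
        fibAvg q ∘ₗ ((Xo ∘ₗ (Xo - G) + (Xo - G) ∘ₗ G) ∘ₗ pull q) := by
  refine LinearMap.ext fun v => ?_
  simp only [siteForm, siteForm₀, LinearMap.sub_apply, LinearMap.add_apply, LinearMap.comp_apply, map_add, map_sub]
  abel

end Forms

/-! ## §2 The (3.66)-shaped majorant of `C = K − K₀` -/

section MajC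

variable {X Y : Type} [Fintype X] [Fintype Y] [DecidableEq Y] {g : B6.Geometry} {σ cr : ℝ}

omit [DecidableEq Y] in
/-- `X∘X∘(Q* + F₂*) ≤ B²(1 + r)c_r·e^{−ρd}` from `X ≤ B·e^{−δd}`, `F₂* ≤ diagK r`, `ρ + σ ≤ δ`. [cite: Balaban1984PropagatorsII, (2.52)–(2.56) pp.232–233] -/
theorem hasMaj_XXP (htri : Triangle254 g) (hd : ∀ a b : g.Site, 0 ≤ g.dist a b) (hrow : RowSum g σ cr) (hσ : 0 ≤ σ) (blk : X → g.Site)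
    (blkY : Y → g.Site) (q : X → Y) (hq : ∀ x, blk x = blkY (q x)) {Xo : (X → ℝ) →ₗ[ℝ] (X → ℝ)} {Fs : (Y → ℝ) →ₗ[ℝ] (X → ℝ)} {B r δ ρ : ℝ}
    (hB : 0 ≤ B) (hr : 0 ≤ r) (hρ : 0 ≤ ρ) (hρδ : ρ + σ ≤ δ)
    (hX : HasMaj (BlockNorm.ofBlocks g blk) (BlockNorm.ofBlocks g blk) Xo (fun y y' => B * Real.exp (-(δ * g.dist y y'))))
    (hFs : HasMaj (BlockNorm.ofBlocks g blkY) (BlockNorm.ofBlocks g blk) Fs (diagK fun _ => r)) :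
    HasMaj (BlockNorm.ofBlocks g blkY) (BlockNorm.ofBlocks g blk) (Xo ∘ₗ (Xo ∘ₗ (pull q + Fs)))
      (fun y y' => B * B * (1 + r) * cr * Real.exp (-(ρ * g.dist y y'))) := by
  have hblk : blk = blkY ∘ q := funext hq
  subst hblk
  have hQs : HasMaj (BlockNorm.ofBlocks g blkY) (BlockNorm.ofBlocks g (blkY ∘ q)) (pull q) (diagK fun _ => 1) := hasMaj_pull blkY q
  have hP : HasMaj (BlockNorm.ofBlocks g blkY) (BlockNorm.ofBlocks g (blkY ∘ q)) (pull q + Fs) (diagK fun _ => 1 + r) :=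
    hasMaj_add_diagK hQs hFs
  have h1 : HasMaj (BlockNorm.ofBlocks g blkY) (BlockNorm.ofBlocks g (blkY ∘ q)) (Xo ∘ₗ (pull q + Fs))
      (fun y y' => B * (1 + r) * Real.exp (-(δ * g.dist y y'))) := hasMaj_exp_comp_diagK (blkY ∘ q) hB hX hP
  have h2 := hasMaj_comp_exp (b₁ := BlockNorm.ofBlocks g blkY) (b₂ := BlockNorm.ofBlocks g (blkY ∘ q)) (b₃ := BlockNorm.ofBlocks g (blkY ∘ q))
    htri hd hrow hB (mul_nonneg hB (by linarith)) hρ (by linarith) hρδ hX h1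
  refine h2.mono fun y y' => le_of_eq ?_
  rw [kappa_ofBlocks]
  ring

/-- **THE (3.66)-SHAPED MAJORANT OF `C = K − K₀`**: with `X ≤ B·e^{−δd}`, `G ≤ β·e^{−δd}`, `X − G ≤ ε·e^{−δd}`, `F₂, F₂* ≤ diagK r`, the block mean `Q ≤ diagK 1` and
`Q* ≤ diagK 1` (`blk = blkY ∘ q`), and `ρ + σ ≤ δ`: `C ≤ [r·B²(1 + r) + B²r + (B + β)ε]·c_r·e^{−ρd}` — small in the averaging letters `r` and in `ε` (`E = GV′X`
carries `V′`), exactly the two small quantities of the print's `O(1)α₁`. [cite: Balaban1985BackgroundPropagators, (3.66) p.403 (shape: «|C(A; y, y′)| ≦ O(1)α₁ … e^{−(1∕2)δ₀d(y,y′)}»)] -/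
theorem hasMaj_siteC (htri : Triangle254 g) (hd : ∀ a b : g.Site, 0 ≤ g.dist a b) (hrow : RowSum g σ cr) (hσ : 0 ≤ σ) (hcr : 0 ≤ cr)
    (blk : X → g.Site) (blkY : Y → g.Site) (q : X → Y) (hq : ∀ x, blk x = blkY (q x))
    {Xo G : (X → ℝ) →ₗ[ℝ] (X → ℝ)} {F : (X → ℝ) →ₗ[ℝ] (Y → ℝ)} {Fs : (Y → ℝ) →ₗ[ℝ] (X → ℝ)} {B β ε r δ ρ : ℝ}
    (hB : 0 ≤ B) (hβ : 0 ≤ β) (hε : 0 ≤ ε) (hr : 0 ≤ r) (hρ : 0 ≤ ρ) (hρδ : ρ + σ ≤ δ)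
    (hX : HasMaj (BlockNorm.ofBlocks g blk) (BlockNorm.ofBlocks g blk) Xo (fun y y' => B * Real.exp (-(δ * g.dist y y'))))
    (hG : HasMaj (BlockNorm.ofBlocks g blk) (BlockNorm.ofBlocks g blk) G (fun y y' => β * Real.exp (-(δ * g.dist y y'))))
    (hE : HasMaj (BlockNorm.ofBlocks g blk) (BlockNorm.ofBlocks g blk) (Xo - G) (fun y y' => ε * Real.exp (-(δ * g.dist y y'))))
    (hF : HasMaj (BlockNorm.ofBlocks g blk) (BlockNorm.ofBlocks g blkY) F (diagK fun _ => r))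
    (hFs : HasMaj (BlockNorm.ofBlocks g blkY) (BlockNorm.ofBlocks g blk) Fs (diagK fun _ => r)) :
    HasMaj (BlockNorm.ofBlocks g blkY) (BlockNorm.ofBlocks g blkY) (siteForm q F Fs Xo - siteForm₀ q G)
      (fun y y' => (r * (B * B * (1 + r)) + B * B * r + (B + β) * ε) * cr * Real.exp (-(ρ * g.dist y y'))) := by
  have hT := hasMaj_XXP htri hd hrow hσ blk blkY q hq hB hr hρ hρδ hX hFs
  have hblk : blk = blkY ∘ q := funext hq
  subst hblk
  have hQ := hasMaj_fibAvg (g := g) (blkY ∘ q) blkY q fun _ => rfl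
  have hQs : HasMaj (BlockNorm.ofBlocks g blkY) (BlockNorm.ofBlocks g (blkY ∘ q)) (pull q) (diagK fun _ => 1) := hasMaj_pull blkY q
  -- term 1: F X X (Q* + F*)
  have t1 : HasMaj (BlockNorm.ofBlocks g blkY) (BlockNorm.ofBlocks g blkY) (F ∘ₗ (Xo ∘ₗ (Xo ∘ₗ (pull q + Fs))))
      (fun y y' => r * (B * B * (1 + r) * cr) * Real.exp (-(ρ * g.dist y y'))) := hasMaj_diagK_comp_exp (blkY ∘ q) hr hF hT
  -- term 2: Q X X F*
  have h3 : HasMaj (BlockNorm.ofBlocks g blkY) (BlockNorm.ofBlocks g (blkY ∘ q)) (Xo ∘ₗ Fs)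
      (fun y y' => B * r * Real.exp (-(δ * g.dist y y'))) := hasMaj_exp_comp_diagK (blkY ∘ q) hB hX hFs
  have h4 := hasMaj_comp_exp (b₁ := BlockNorm.ofBlocks g blkY) (b₂ := BlockNorm.ofBlocks g (blkY ∘ q)) (b₃ := BlockNorm.ofBlocks g (blkY ∘ q))
    htri hd hrow hB (mul_nonneg hB hr) hρ (by linarith) hρδ hX h3
  have t2 : HasMaj (BlockNorm.ofBlocks g blkY) (BlockNorm.ofBlocks g blkY) (fibAvg q ∘ₗ (Xo ∘ₗ (Xo ∘ₗ Fs)))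
      (fun y y' => 1 * ((BlockNorm.ofBlocks g (blkY ∘ q)).κ * B * (B * r) * cr) * Real.exp (-(ρ * g.dist y y'))) :=
    hasMaj_diagK_comp_exp (blkY ∘ q) zero_le_one hQ h4
  -- term 3: Q (X E + E G) Q*
  have h5 := hasMaj_comp_exp (b₁ := BlockNorm.ofBlocks g (blkY ∘ q)) (b₂ := BlockNorm.ofBlocks g (blkY ∘ q))
    (b₃ := BlockNorm.ofBlocks g (blkY ∘ q)) htri hd hrow hB hε hρ (by linarith) hρδ hX hE
  have h6 := hasMaj_comp_exp (b₁ := BlockNorm.ofBlocks g (blkY ∘ q)) (b₂ := BlockNorm.ofBlocks g (blkY ∘ q))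
    (b₃ := BlockNorm.ofBlocks g (blkY ∘ q)) htri hd hrow hε hβ hρ (by linarith) hρδ hE hG
  have h56 := hasMaj_add_exp h5 h6
  have hnn : 0 ≤ (BlockNorm.ofBlocks g (blkY ∘ q)).κ * B * ε * cr + (BlockNorm.ofBlocks g (blkY ∘ q)).κ * ε * β * cr := by
    rw [kappa_ofBlocks]
    exact add_nonneg (mul_nonneg (mul_nonneg (mul_nonneg zero_le_one hB) hε) hcr) (mul_nonneg (mul_nonneg (mul_nonneg zero_le_one hε) hβ) hcr)
  have h7 : HasMaj (BlockNorm.ofBlocks g blkY) (BlockNorm.ofBlocks g (blkY ∘ q)) ((Xo ∘ₗ (Xo - G) + (Xo - G) ∘ₗ G) ∘ₗ pull q)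
      (fun y y' => ((BlockNorm.ofBlocks g (blkY ∘ q)).κ * B * ε * cr + (BlockNorm.ofBlocks g (blkY ∘ q)).κ * ε * β * cr) * 1 *
        Real.exp (-(ρ * g.dist y y'))) := hasMaj_exp_comp_diagK (blkY ∘ q) hnn h56 hQs
  have t3 := hasMaj_diagK_comp_exp (blkY ∘ q) zero_le_one hQ h7
  rw [siteForm_sub_siteForm₀]
  refine ((t1.add t2).add t3).mono fun y y' => le_of_eq ?_
  simp only [kappa_ofBlocks]
  ring

end MajC

/-! ## §3 The η-defect of the dressed site form, by Leibniz -/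

section Defect

variable {X X' Y : Type} [Fintype X] [Fintype X'] [Fintype Y] [DecidableEq X] [DecidableEq Y] {g : B6.Geometry} {σ cr : ℝ}

/-- **THE η-DEFECT OF THE DRESSED SITE FORM** through the identity transport of the common site lattice (inputs AND outputs), the lattice functions
transported by `τ = pull π` with UNIFORM fibres `#π⁻¹x = N ≥ 1` (King's pairing; then `𝔇(Q′, Q) = 0 = 𝔇(Q′*, Q*)`, g4 F1): letters `X, X′ ≤ B·e^{−δd}`,
`𝔇(X′, X) ≤ m·e^{−δd}` (the operator layer's OUTPUT), `F₂, F₂′, F₂*, F₂*′ ≤ diagK r`, `𝔇(F₂′, F₂) ≤ diagK o` (through `(τ, 1)`), `𝔇(F₂*′, F₂*) ≤ diagK o`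
(through `(1, τ)`), `ρ + σ ≤ δ`:  `𝔇(K′, K) ≤ 2(1 + r)·B·c_r·(B·o + m·(1 + r))·e^{−ρd}` — rate-small exactly when `m` and `o` are.  NOT PRINTED (no η-rate is);
mechanism of (3.65). [cite: Balaban1985BackgroundPropagators, (3.65)–(3.66) p.403 (mechanism); King1986, p.664 (pairing convention)] -/
theorem hasMaj_idef_siteForm (htri : Triangle254 g) (hd : ∀ a b : g.Site, 0 ≤ g.dist a b) (hrow : RowSum g σ cr) (hσ : 0 ≤ σ)
    (blk : X → g.Site) (blkY : Y → g.Site) (q : X → Y) (π : X' → X) (hq : ∀ x, blk x = blkY (q x)) {N : ℕ} (hN : N ≠ 0)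
    (hfib : ∀ x, (fibre π x).card = N)
    {Xo : (X → ℝ) →ₗ[ℝ] (X → ℝ)} {Xo' : (X' → ℝ) →ₗ[ℝ] (X' → ℝ)} {F : (X → ℝ) →ₗ[ℝ] (Y → ℝ)} {F' : (X' → ℝ) →ₗ[ℝ] (Y → ℝ)}
    {Fs : (Y → ℝ) →ₗ[ℝ] (X → ℝ)} {Fs' : (Y → ℝ) →ₗ[ℝ] (X' → ℝ)} {B m r o δ ρ : ℝ}
    (hB : 0 ≤ B) (hm : 0 ≤ m) (hr : 0 ≤ r) (ho : 0 ≤ o) (hρ : 0 ≤ ρ) (hρδ : ρ + σ ≤ δ)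
    (hX : HasMaj (BlockNorm.ofBlocks g blk) (BlockNorm.ofBlocks g blk) Xo (fun y y' => B * Real.exp (-(δ * g.dist y y'))))
    (hX' : HasMaj (BlockNorm.ofBlocks g (blk ∘ π)) (BlockNorm.ofBlocks g (blk ∘ π)) Xo' (fun y y' => B * Real.exp (-(δ * g.dist y y'))))
    (hDX : HasMaj (BlockNorm.ofBlocks g blk) (BlockNorm.ofBlocks g (blk ∘ π)) (idef (pull π) (pull π) Xo' Xo)
      (fun y y' => m * Real.exp (-(δ * g.dist y y'))))
    (hFs : HasMaj (BlockNorm.ofBlocks g blkY) (BlockNorm.ofBlocks g blk) Fs (diagK fun _ => r))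
    (hF' : HasMaj (BlockNorm.ofBlocks g (blk ∘ π)) (BlockNorm.ofBlocks g blkY) F' (diagK fun _ => r))
    (hFs' : HasMaj (BlockNorm.ofBlocks g blkY) (BlockNorm.ofBlocks g (blk ∘ π)) Fs' (diagK fun _ => r))
    (hDF : HasMaj (BlockNorm.ofBlocks g blk) (BlockNorm.ofBlocks g blkY) (idef (pull π) LinearMap.id F' F) (diagK fun _ => o))
    (hDFs : HasMaj (BlockNorm.ofBlocks g blkY) (BlockNorm.ofBlocks g (blk ∘ π)) (idef LinearMap.id (pull π) Fs' Fs) (diagK fun _ => o)) :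
    HasMaj (BlockNorm.ofBlocks g blkY) (BlockNorm.ofBlocks g blkY)
      (idef LinearMap.id LinearMap.id (siteForm (q ∘ π) F' Fs' Xo') (siteForm q F Fs Xo))
      (fun y y' => 2 * (1 + r) * B * cr * (B * o + m * (1 + r)) * Real.exp (-(ρ * g.dist y y'))) := by
  have hblk : blk = blkY ∘ q := funext hq
  subst hblk
  -- the block means and the pull-backs of the two spacings
  have hQ' := hasMaj_fibAvg (g := g) ((blkY ∘ q) ∘ π) blkY (q ∘ π) fun _ => rfl
  have hQs : HasMaj (BlockNorm.ofBlocks g blkY) (BlockNorm.ofBlocks g (blkY ∘ q)) (pull q) (diagK fun _ => 1) := hasMaj_pull blkY q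
  have hP' : HasMaj (BlockNorm.ofBlocks g ((blkY ∘ q) ∘ π)) (BlockNorm.ofBlocks g blkY) (fibAvg (q ∘ π) + F') (diagK fun _ => 1 + r) :=
    hasMaj_add_diagK hQ' hF'
  have hPs : HasMaj (BlockNorm.ofBlocks g blkY) (BlockNorm.ofBlocks g (blkY ∘ q)) (pull q + Fs) (diagK fun _ => 1 + r) :=
    hasMaj_add_diagK hQs hFs
  -- the exact intertwinings: 𝔇(Q*′ + F*′, Q* + F*) = 𝔇(F*′, F*), 𝔇(Q′ + F′, Q + F) = 𝔇(F′, F)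
  have e1 : idef LinearMap.id (pull π) (pull ((q ∘ π)) + Fs') (pull q + Fs) = idef LinearMap.id (pull π) Fs' Fs := by
    rw [idef_add, idef_pull_eq_zero q π, zero_add]
  have e2 : idef (pull π) LinearMap.id (fibAvg (q ∘ π) + F') (fibAvg q + F) = idef (pull π) LinearMap.id F' F := by
    rw [idef_add, idef_fibAvg_eq_zero q π hN hfib, zero_add]
  -- A₂ = X′ ∘ 𝔇(P*′, P*) ≤ B·o·e^{−δd}
  have hA1 : HasMaj (BlockNorm.ofBlocks g blkY) (BlockNorm.ofBlocks g ((blkY ∘ q) ∘ π))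
      (idef LinearMap.id (pull π) (pull (q ∘ π) + Fs') (pull q + Fs)) (diagK fun _ => o) := by rw [e1]; exact hDFs
  have hA2 : HasMaj (BlockNorm.ofBlocks g blkY) (BlockNorm.ofBlocks g ((blkY ∘ q) ∘ π))
      (Xo' ∘ₗ idef LinearMap.id (pull π) (pull (q ∘ π) + Fs') (pull q + Fs)) (fun y y' => B * o * Real.exp (-(δ * g.dist y y'))) :=
    hasMaj_exp_comp_diagK ((blkY ∘ q) ∘ π) hB hX' hA1
  -- A₃ = 𝔇(X′, X) ∘ P* ≤ m(1 + r)·e^{−δd}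
  have hA3 : HasMaj (BlockNorm.ofBlocks g blkY) (BlockNorm.ofBlocks g ((blkY ∘ q) ∘ π))
      (idef (pull π) (pull π) Xo' Xo ∘ₗ (pull q + Fs)) (fun y y' => m * (1 + r) * Real.exp (-(δ * g.dist y y'))) :=
    hasMaj_exp_comp_diagK (blkY ∘ q) hm hDX hPs
  -- A₄ = 𝔇(X′P*′, XP*) = A₂ + A₃
  have hA4 : HasMaj (BlockNorm.ofBlocks g blkY) (BlockNorm.ofBlocks g ((blkY ∘ q) ∘ π))
      (idef LinearMap.id (pull π) (Xo' ∘ₗ (pull (q ∘ π) + Fs')) (Xo ∘ₗ (pull q + Fs)))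
      (fun y y' => (B * o + m * (1 + r)) * Real.exp (-(δ * g.dist y y'))) := by
    rw [idef_comp LinearMap.id (pull π) (pull π)]
    exact hasMaj_add_exp hA2 hA3
  -- A₅ = X′ ∘ A₄ ≤ B(Bo + m(1+r))c_r·e^{−ρd}
  have hA5 := hasMaj_comp_exp (b₁ := BlockNorm.ofBlocks g blkY) (b₂ := BlockNorm.ofBlocks g ((blkY ∘ q) ∘ π))
    (b₃ := BlockNorm.ofBlocks g ((blkY ∘ q) ∘ π)) htri hd hrow hB (add_nonneg (mul_nonneg hB ho) (mul_nonneg hm (by linarith))) hρ (by linarith)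
    hρδ hX' hA4
  -- A₆ = 𝔇(X′, X) ∘ (X ∘ P*) ≤ m·B(1+r)·c_r·e^{−ρd}
  have hXP : HasMaj (BlockNorm.ofBlocks g blkY) (BlockNorm.ofBlocks g (blkY ∘ q)) (Xo ∘ₗ (pull q + Fs))
      (fun y y' => B * (1 + r) * Real.exp (-(δ * g.dist y y'))) := hasMaj_exp_comp_diagK (blkY ∘ q) hB hX hPs
  have hA6 := hasMaj_comp_exp (b₁ := BlockNorm.ofBlocks g blkY) (b₂ := BlockNorm.ofBlocks g (blkY ∘ q))
    (b₃ := BlockNorm.ofBlocks g ((blkY ∘ q) ∘ π)) htri hd hrow hm (mul_nonneg hB (by linarith)) hρ (by linarith) hρδ hDX hXP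
  -- A₇ = 𝔇(T′, T) = A₅ + A₆
  have hA7 : HasMaj (BlockNorm.ofBlocks g blkY) (BlockNorm.ofBlocks g ((blkY ∘ q) ∘ π))
      (idef LinearMap.id (pull π) (Xo' ∘ₗ (Xo' ∘ₗ (pull (q ∘ π) + Fs'))) (Xo ∘ₗ (Xo ∘ₗ (pull q + Fs))))
      (fun y y' => ((BlockNorm.ofBlocks g ((blkY ∘ q) ∘ π)).κ * B * (B * o + m * (1 + r)) * cr +
        (BlockNorm.ofBlocks g (blkY ∘ q)).κ * m * (B * (1 + r)) * cr) * Real.exp (-(ρ * g.dist y y'))) := by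
    rw [idef_comp LinearMap.id (pull π) (pull π)]
    exact hasMaj_add_exp hA5 hA6
  -- A₈ = P′ ∘ A₇
  have hA8 := hasMaj_diagK_comp_exp ((blkY ∘ q) ∘ π) (by linarith : (0:ℝ) ≤ 1 + r) hP' hA7
  -- A₉ = 𝔇(P′, P) ∘ T
  have hT := hasMaj_XXP htri hd hrow hσ (blkY ∘ q) blkY q (fun _ => rfl) hB hr hρ hρδ hX hFs
  have hDP : HasMaj (BlockNorm.ofBlocks g (blkY ∘ q)) (BlockNorm.ofBlocks g blkY)
      (idef (pull π) LinearMap.id (fibAvg (q ∘ π) + F') (fibAvg q + F)) (diagK fun _ => o) := by rw [e2]; exact hDF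
  have hA9 := hasMaj_diagK_comp_exp (blkY ∘ q) ho hDP hT
  -- assemble
  unfold siteForm
  rw [idef_comp LinearMap.id (pull π) LinearMap.id]
  refine (hA8.add hA9).mono fun y y' => le_of_eq ?_
  simp only [kappa_ofBlocks]
  ring

end Defect

end Summit.QuantumFields.YangMills.BalabanUVNodes.N15.SiteLayer

end
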